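import Mathlib
import HarnessLib
import Literature.MathematicalPhysics.QuantumLattice.KohnLuttinger
import Literature.MathematicalPhysics.QuantumLattice.FermiRG.FST2Hypotheses
import Summits.HubbardSuperconductivity.HubbardSuperconductivity.Theorems.WeakCouplingBCSKlCertTPrimePHReflectionMeasure

/-!
# Route `WeakCouplingBCS` — certificate half of stmt-HubbardSuperconductivity-0158, scan «KL-MARGIN-SCAN»:
# the CONVEXITY CHART of the `t`–`t′` Fermi curve (located item «(KLSCAN)-TPRIME-CONVEXITY»)

Cell `gate-hubbard-kl`, reader seat hubbard-klscan-idea-4 (lens «cascade»), round-3 crux idea «tprime-convexity-chart»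
(card sha16 2312ecaa9f3ad367, evidence on stmt-HubbardSuperconductivity-0158; graded NEW-COMBINATION (located, operational) / KEEP
by refuter hubbard-klscan-crit-1, STATUS 2026-08-28T22:29:29Z, with a first-hand cross-check of the chart).  This file is the
tree-ready form of that card's `Sketch.lean` (fce74e58842593a1): elementary real analysis of the band
`ε_{t′}(k) = −2(cos k₀ + cos k₁) − 4t′ cos k₀ cos k₁ = squareDispersion 1 t′` (hopping `t = 1`), ADDITIVE (no existing
declaration is touched; no `instance`, no `notation`, no named fact), in its own namespace `…Theorems.KlTPrimeConvexity`.

WHY.  The Kohn–Luttinger certificate rows of the scan (vocabulary `…Theorems.WeakCouplingBCSDefsKlCertTPrime`, soundness via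
`…KlCertTPrimeAnalyticOfEngineRows`) need NO convexity of the Fermi curve.  But every sector-based Fermi-liquid engine typed in the
tree — the only consumers that could chain a certified `t′` cell into an FKT-scale statement — carries a STRICT-CONVEXITY
hypothesis on the Fermi curve: `Literature…FermiRG.HypA3 e` (FST II (A3): `∀ p ∈ {e = 0}, ∀ v ≠ 0, ⟪∇e p, v⟫ = 0 → 0 < hessQuad e p v`;
only tree instance `klfs_hypA3`, `t′ = 0`), `…FermiRG.BGM2003.DispersionHyp.convex`, FST IV's curvature floor.  For the `t`–`t′`
band the hole-like Fermi curve about `Γ` LOSES convexity between the convexity-return level `μ_c(t′) = 8t′ − 16t′³` and the van Hove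
level `4t′` (González–Guinea–Vozmediano, Phys. Rev. Lett. 79 (1997) 3514 = arXiv:cond-mat/9703254, p. 1; Fratini–Guinea,
Phys. Rev. B 66 (2002) 125104, App. A: nodal criterion `cos k_d = 2|t′|`).  This file PROVES that chart at the level of the typed
hypothesis: on that band `HypA3` fails in both orientations; at `t′ = 0` the curvature numerator is positive on every Fermi curve
with `−4 < μ < 0`.  Operational reading (crit-1): an eligibility label «KL-only» for the 23 inflection nodes of the 64-node scan grid and
a queue order (M-side / far-`Γ` cells first) for any future FKT-scale consumer — not a defect of any typed leaf.

CONTENTS (this file = §§1–3b; §3c «(A3) fails on the inflection band» + §4 anchors live in the companion module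
`…Theorems.WeakCouplingBCSKlCertTPrimeConvexityA3` — split for the 400-line statement-form lint, declarations unchanged).
* §1 `one_sub_tp_mul_squareDispersion`: `1 − t′ε_{t′}(k) = (1 + 2t′cos k₀)(1 + 2t′cos k₁)`; its logarithmic (separable) form for
  `|t′| < 1/2`; the effective nearest-neighbour level `klMuEff` with `klMuEff_vanHove` (`μ_eff = 0` exactly at `μ = 4t′`).
* §2 the coordinate partials `dx, dy, dxx, dyy, dxy` of `ε_{t′}` (with `HasDerivAt` certificates) and the level-set curvature
  numerator `curvNum = ε_xx ε_y² − 2ε_xy ε_x ε_y + ε_yy ε_x²`; closed forms on the axis (`curvNum_axis`, positive) and on the zone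
  diagonal (`curvNum_diag = 4ε_x²(cos x + 2t′)`, the nodal criterion); `convexityReturnLevel t′ = 8t′ − 16t′³`;
  `nodal_neg_iff`: at a diagonal point of the level-`μ` curve, `N < 0 ⟺ μ_c(t′) < μ`.
* §3 `KLInflectionTP` / `KLCurvSignConstantTP` (the typed side condition a `t′`-cell consumer would carry) and
  **`gammaSide_inflection`**: for `−1/2 < t′ < 0`, `μ_c(t′) < μ < 4t′` the Fermi curve carries two points with curvature numerators of
  opposite sign (two intermediate-value arguments with explicit witnesses); §3b **`nn_curvNum_pos`** / `nn_curvSignConstant` (`t′ = 0`).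
* §3c the Hessian form of `e = ε_{t′} − μ` in coordinates (`klcc_hasFDerivAt_e`, `klcc_iteratedFDeriv_two_e`, **`klcc_hessQuad_e`**:
  `FermiRG.hessQuad e p v = ε_xx v₀² + 2ε_xy v₀v₁ + ε_yy v₁²`, built on the tree's `klph_hasGradientAt_squareDispersion` /
  `klph_gradient_squareDispersion`), `hessQuad_tvec` (`hessQuad e k (−ε_y, ε_x) = N(k)`), and **`gammaSide_not_hypA3`**:
  `¬ HypA3 (ε_{t′} − μ) ∧ ¬ HypA3 (μ − ε_{t′})` on the inflection band.
* §4 exact rational anchors for the scan's `t′` rows: `μ_c(−0.1) = −0.784`, `μ_c(−0.2) = −1.472`, `μ_c(−0.3) = −1.968`; the cell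
  `(δ, t′) = (0.20, −0.1)` (`μ = −0.6148`, margin-1 bracket) is an inflection cell and violates (A3); the director's first target
  `(1/8, −0.3)` (`μ ≈ −0.9596 > 4t′`) is M-side, outside the band (the theorems are silent there, as they should be).

NOT HERE (deliberately): the M-side / far-`Γ` CONVEXITY (a curvature FLOOR `c > 0` for `μ < μ_c(t′)` or `μ > 4t′`; float-true on
every such scan cell, `|κ| ≥ 0.27` at `(1/8, −0.3)`) — a separate leaf if a consumer is ever typed; any statement about margins,
windows, `U₀`, K₃ or superconductivity.  A Kohn–Luttinger channel statement is not ODLRO; no FKT-scale statement exists in the tree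
for any `t′ ≠ 0` cell.

References: J. González, F. Guinea, M. A. H. Vozmediano, Phys. Rev. Lett. 79 (1997) 3514 (arXiv:cond-mat/9703254); S. Fratini,
F. Guinea, Phys. Rev. B 66 (2002) 125104, App. A; J. Feldman, M. Salmhofer, E. Trubowitz, *Regularity of interacting nonspherical
Fermi surfaces: the full self-energy*, Comm. Pure Appl. Math. 52 (1999) 273, hypothesis (A3) (tree: `FermiRG.FST2Hypotheses`);
G. Benfatto, A. Giuliani, V. Mastropietro, Ann. Henri Poincaré 4 (2003) 137, §1 (strict convexity).
-/

noncomputable section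

-- the tree's namespace `Summit.<Summit>.<Problem>.Theorems` repeats the summit name by design (D-0017)
set_option linter.dupNamespace false

namespace Summit.HubbardSuperconductivity.HubbardSuperconductivity.Theorems.KlTPrimeConvexity

open Real Set Literature.MathematicalPhysics.QuantumLattice

/-- An explicit momentum point `(x, y)`. [folklore] -/
def mk (x y : ℝ) : Momentum := WithLp.toLp 2 ![x, y]

/-- First coordinate of `mk x y`. [folklore] -/
@[simp] theorem mk_apply_zero (x y : ℝ) : mk x y 0 = x := by simp [mk]
/-- Second coordinate of `mk x y`. [folklore] -/
@[simp] theorem mk_apply_one (x y : ℝ) : mk x y 1 = y := by simp [mk]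

/-- `mk x y` lies in the Brillouin zone `[-π, π)²` when both coordinates do. [folklore] -/
theorem mk_mem_brillouinZone {x y : ℝ} (hx : x ∈ Ico (-π) π) (hy : y ∈ Ico (-π) π) : mk x y ∈ brillouinZone := by
  intro i
  fin_cases i
  · simpa using hx
  · simpa using hy

/-! ### §1  The exact factorisation / conjugacy to the nearest-neighbour foliation -/

/-- `1 - t′·ε_{t′}(k) = (1 + 2t′cos k₀)(1 + 2t′cos k₁)` (hopping `t = 1`). [folklore] -/
theorem one_sub_tp_mul_squareDispersion (tp : ℝ) (k : Momentum) :
    1 - tp * squareDispersion 1 tp k = (1 + 2 * tp * cos (k 0)) * (1 + 2 * tp * cos (k 1)) := by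
  simp only [squareDispersion]
  ring

/-- `0 < 1 + 2t′cos x` for `|t′| < 1/2`. [folklore] -/
theorem one_add_two_tp_cos_pos {tp : ℝ} (htp : |tp| < 1 / 2) (x : ℝ) : 0 < 1 + 2 * tp * cos x := by
  have h1 : |tp * cos x| ≤ |tp| := by
    rw [abs_mul]
    exact mul_le_of_le_one_right (abs_nonneg _) (abs_cos_le_one x)
  have h2 := neg_abs_le (tp * cos x)
  nlinarith

/-- Logarithmic (separable) form: `log(1 - t′ε_{t′}(k)) = G(k₀) + G(k₁)` with `G = log(1 + 2t′cos ·)`, for `|t′| < 1/2`.  Hence every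
level set of `ε_{t′}` is a level set of the separable function `G(k₀) + G(k₁)`, i.e. (after the monotone reparametrisation
`cos u = (log(1 - 4t′²) - 2G(x)) / log((1 + 2|t′|)/(1 - 2|t′|))` of each axis) a nearest-neighbour Fermi curve. [folklore] -/
theorem log_one_sub_tp_mul_squareDispersion {tp : ℝ} (htp : |tp| < 1 / 2) (k : Momentum) :
    Real.log (1 - tp * squareDispersion 1 tp k)
      = Real.log (1 + 2 * tp * cos (k 0)) + Real.log (1 + 2 * tp * cos (k 1)) := by
  rw [one_sub_tp_mul_squareDispersion,
    Real.log_mul (one_add_two_tp_cos_pos htp _).ne' (one_add_two_tp_cos_pos htp _).ne']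

/-- The effective nearest-neighbour level `μ_eff(t′, μ) = 4·log((1 - μt′)/(1 - 4t′²)) / log((1 + 2|t′|)/(1 - 2|t′|))`: the `t`–`t′` Fermi
curve at `μ` is the NN Fermi curve at `μ_eff` pulled back by the separable diffeomorphism (module docstring §1). [folklore] -/
def klMuEff (tp μ : ℝ) : ℝ :=
  4 * Real.log ((1 - μ * tp) / (1 - 4 * tp ^ 2)) / Real.log ((1 + 2 * |tp|) / (1 - 2 * |tp|))

/-- Van Hove ⟺ `μ_eff = 0`: at the saddle level `μ = 4t′` the effective NN level is half filling. [folklore] -/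
theorem klMuEff_vanHove (tp : ℝ) (h : 1 - 4 * tp ^ 2 ≠ 0) : klMuEff tp (4 * tp) = 0 := by
  unfold klMuEff
  have h1 : (1 - 4 * tp * tp) / (1 - 4 * tp ^ 2) = 1 := by
    rw [div_eq_one_iff_eq h]
    ring
  rw [h1, Real.log_one]
  simp

/-! ### §2  The level-set curvature numerator of `ε_{t′}` -/

/-- `∂₀ε_{t′}(x, y) = 2 sin x (1 + 2t′cos y)` (hopping `t = 1`; the five coordinate partials of `ε_{t′}` are written out as
closed forms `dx, dy, dxx, dyy, dxy`, each with a `HasDerivAt` certificate below). [folklore] -/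
def dx (tp x y : ℝ) : ℝ := 2 * sin x * (1 + 2 * tp * cos y)
/-- `∂₁ε_{t′}(x, y) = 2 sin y (1 + 2t′cos x)`. [folklore] -/
def dy (tp x y : ℝ) : ℝ := 2 * sin y * (1 + 2 * tp * cos x)
/-- `∂₀₀ε_{t′}(x, y) = 2 cos x (1 + 2t′cos y)`. [folklore] -/
def dxx (tp x y : ℝ) : ℝ := 2 * cos x * (1 + 2 * tp * cos y)
/-- `∂₁₁ε_{t′}(x, y) = 2 cos y (1 + 2t′cos x)`. [folklore] -/
def dyy (tp x y : ℝ) : ℝ := 2 * cos y * (1 + 2 * tp * cos x)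
/-- `∂₀₁ε_{t′}(x, y) = -4t′ sin x sin y`. [folklore] -/
def dxy (tp x y : ℝ) : ℝ := -4 * tp * sin x * sin y

/-- `dx` is the partial derivative of `ε_{t′}` in the first coordinate. [folklore] -/
theorem hasDerivAt_squareDispersion_fst (tp x y : ℝ) :
    HasDerivAt (fun x' => squareDispersion 1 tp (mk x' y)) (dx tp x y) x := by
  have h : (fun x' => squareDispersion 1 tp (mk x' y)) = fun x' => -2 * (cos x' + cos y) - 4 * tp * cos x' * cos y := by
    funext x'; simp [squareDispersion]
  have h1 := ((hasDerivAt_cos x).add_const (cos y)).const_mul (-2 : ℝ)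
  have h2 := ((hasDerivAt_cos x).const_mul (4 * tp)).mul_const (cos y)
  have e : -2 * -sin x - 4 * tp * -sin x * cos y = dx tp x y := by simp only [dx]; ring
  rw [h, ← e]
  exact h1.sub h2

/-- `dxx` is the second partial derivative of `ε_{t′}` in the first coordinate. [folklore] -/
theorem hasDerivAt_dx (tp x y : ℝ) : HasDerivAt (fun x' => dx tp x' y) (dxx tp x y) x := by
  exact ((hasDerivAt_sin x).const_mul (2 : ℝ)).mul_const (1 + 2 * tp * cos y)

/-- `dxy` is the mixed partial derivative. [folklore] -/
theorem hasDerivAt_dx_snd (tp x y : ℝ) : HasDerivAt (fun y' => dx tp x y') (dxy tp x y) y := by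
  have h := (((hasDerivAt_cos y).const_mul (2 * tp)).const_add 1).const_mul (2 * sin x)
  have e : 2 * sin x * (2 * tp * -sin y) = dxy tp x y := by simp only [dxy]; ring
  rw [← e]
  exact h

/-- The remaining partials by the diagonal reflection: `∂₁ε(x,y) = ∂₀ε(y,x)`. [folklore] -/
theorem dy_eq_dx_swap (tp x y : ℝ) : dy tp x y = dx tp y x := rfl
/-- `∂₁₁ε(x,y) = ∂₀₀ε(y,x)`. [folklore] -/
theorem dyy_eq_dxx_swap (tp x y : ℝ) : dyy tp x y = dxx tp y x := rfl
/-- The mixed partial is symmetric under the diagonal reflection. [folklore] -/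
theorem dxy_swap (tp x y : ℝ) : dxy tp y x = dxy tp x y := by unfold dxy; ring

/-- The curvature numerator of the level sets of `ε_{t′}`: `N = ε_xx ε_y² - 2 ε_xy ε_x ε_y + ε_yy ε_x²`
(signed curvature `= N / ‖∇ε‖³` up to orientation; an inflection point is a sign change of `N` along the curve). [folklore] -/
def curvNum (tp x y : ℝ) : ℝ :=
  dxx tp x y * dy tp x y ^ 2 - 2 * dxy tp x y * dx tp x y * dy tp x y + dyy tp x y * dx tp x y ^ 2

/-- `D₄`: the numerator is symmetric under the diagonal reflection. [folklore] -/
theorem curvNum_swap (tp x y : ℝ) : curvNum tp y x = curvNum tp x y := by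
  simp only [curvNum, dx, dy, dxx, dyy, dxy]; ring

/-- On the axis `k₀ = 0`: `N(0, y) = 2(1 + 2t′cos y)·(2 sin y (1 + 2t′))²`. [folklore] -/
theorem curvNum_axis (tp y : ℝ) :
    curvNum tp 0 y = 2 * (1 + 2 * tp * cos y) * (2 * sin y * (1 + 2 * tp)) ^ 2 := by
  simp only [curvNum, dx, dy, dxx, dyy, dxy, sin_zero, cos_zero]
  ring

/-- The axis point has a POSITIVE curvature numerator (`|t′| < 1/2`, `sin y ≠ 0`). [folklore] -/
theorem curvNum_axis_pos {tp : ℝ} (htp : |tp| < 1 / 2) {y : ℝ} (hy : sin y ≠ 0) : 0 < curvNum tp 0 y := by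
  rw [curvNum_axis]
  have h1 := one_add_two_tp_cos_pos htp y
  have h2 : 0 < 1 + 2 * tp := by
    have := (abs_lt.mp htp).1
    linarith
  have h3 : 2 * sin y * (1 + 2 * tp) ≠ 0 := mul_ne_zero (mul_ne_zero two_ne_zero hy) h2.ne'
  positivity

/-- On the zone diagonal: `N(x, x) = 4 ε_x² (cos x + 2t′)` — the NODAL CONVEXITY CRITERION (Fratini–Guinea App. A, `B = 0`). [folklore] -/
theorem curvNum_diag (tp x : ℝ) :
    curvNum tp x x = 4 * (2 * sin x * (1 + 2 * tp * cos x)) ^ 2 * (cos x + 2 * tp) := by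
  have h := sin_sq_add_cos_sq x
  simp only [curvNum, dx, dy, dxx, dyy, dxy]
  linear_combination (8 * tp * (2 * sin x * (1 + 2 * tp * cos x)) ^ 2) * h

/-- At a regular diagonal point: `N(x, x) < 0 ⟺ cos x + 2t′ < 0`. [folklore] -/
theorem curvNum_diag_neg_iff (tp x : ℝ) (he : 2 * sin x * (1 + 2 * tp * cos x) ≠ 0) :
    curvNum tp x x < 0 ↔ cos x + 2 * tp < 0 := by
  rw [curvNum_diag]
  have hp : 0 < 4 * (2 * sin x * (1 + 2 * tp * cos x)) ^ 2 := by positivity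
  constructor
  · intro h
    by_contra hc
    exact absurd h (not_lt.mpr (mul_nonneg hp.le (not_lt.mp hc)))
  · exact fun h => mul_neg_of_pos_of_neg hp h

/-- The diagonal level function `c ↦ ε_{t′}(x, x)` at `cos x = c`. [folklore] -/
theorem squareDispersion_diag (tp x : ℝ) : squareDispersion 1 tp (mk x x) = -4 * cos x - 4 * tp * cos x ^ 2 := by
  simp [squareDispersion]
  ring

/-- The axis level function: `ε_{t′}(0, y) = -2 - (2 + 4t′) cos y`. [folklore] -/
theorem squareDispersion_axis (tp y : ℝ) : squareDispersion 1 tp (mk 0 y) = -2 - (2 + 4 * tp) * cos y := by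
  simp [squareDispersion]
  ring

/-- The CONVEXITY-RETURN level `μ_c(t′) = 8t′ - 16t′³` = the level of the diagonal point with `cos k_d = -2t′`. [folklore] -/
def convexityReturnLevel (tp : ℝ) : ℝ := 8 * tp - 16 * tp ^ 3

/-- The diagonal point with `cos x = -2t′` sits at the level `μ_c(t′)`. [folklore] -/
theorem level_at_nodal_threshold (tp x : ℝ) (hx : cos x = -2 * tp) :
    squareDispersion 1 tp (mk x x) = convexityReturnLevel tp := by
  rw [squareDispersion_diag, hx, convexityReturnLevel]
  ring

/-- The diagonal level is strictly decreasing in `c = cos x ∈ [-1, 1]` when `|t′| < 1/2`. [folklore] -/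
theorem diagLevel_strictAntiOn {tp : ℝ} (htp : |tp| < 1 / 2) :
    StrictAntiOn (fun c : ℝ => -4 * c - 4 * tp * c ^ 2) (Icc (-1) 1) := by
  intro a ha b hb hab
  have h1 : |tp * (a + b)| ≤ |tp| * 2 := by
    rw [abs_mul]
    gcongr
    exact abs_le.mpr ⟨by linarith [ha.1, hb.1], by linarith [ha.2, hb.2]⟩
  have h2 := neg_abs_le (tp * (a + b))
  have h3 : 0 < 4 + 4 * (tp * (a + b)) := by nlinarith
  show -4 * b - 4 * tp * b ^ 2 < -4 * a - 4 * tp * a ^ 2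
  nlinarith [mul_pos (sub_pos.mpr hab) h3]

/-- **Nodal criterion.** At a diagonal point `(x, x)`, `0 < x < π`, of the level-`μ` curve: `N < 0 ⟺ μ_c(t′) < μ`. [folklore] -/
theorem nodal_neg_iff {tp μ x : ℝ} (htp : |tp| < 1 / 2) (hx0 : 0 < x) (hxπ : x < π)
    (hμ : squareDispersion 1 tp (mk x x) = μ) : curvNum tp x x < 0 ↔ convexityReturnLevel tp < μ := by
  have hs : 0 < sin x := sin_pos_of_pos_of_lt_pi hx0 hxπ
  have hc := one_add_two_tp_cos_pos htp x
  have he : 2 * sin x * (1 + 2 * tp * cos x) ≠ 0 := (mul_pos (mul_pos two_pos hs) hc).ne'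
  rw [curvNum_diag_neg_iff tp x he]
  have hcx : cos x ∈ Icc (-1 : ℝ) 1 := ⟨neg_one_le_cos x, cos_le_one x⟩
  have htp' : -2 * tp ∈ Icc (-1 : ℝ) 1 := by
    constructor <;> linarith [(abs_lt.mp htp).1, (abs_lt.mp htp).2]
  have key : -4 * (-2 * tp) - 4 * tp * (-2 * tp) ^ 2 < -4 * cos x - 4 * tp * cos x ^ 2 ↔ cos x < -2 * tp :=
    (diagLevel_strictAntiOn htp).lt_iff_gt htp' hcx
  rw [squareDispersion_diag] at hμ
  have hthr : -4 * (-2 * tp) - 4 * tp * (-2 * tp) ^ 2 = convexityReturnLevel tp := by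
    simp only [convexityReturnLevel]; ring
  rw [hthr, hμ] at key
  rw [key]
  constructor <;> intro h <;> linarith

/-! ### §3  The Γ-side chart: two points of opposite curvature sign -/

/-- A `t′`-cell's Fermi curve carries an INFLECTION: two points with curvature numerators of opposite sign. [folklore] -/
def KLInflectionTP (tp μ : ℝ) : Prop :=
  ∃ k ∈ fermiCurve (squareDispersion 1 tp) μ, ∃ k' ∈ fermiCurve (squareDispersion 1 tp) μ,
    curvNum tp (k 0) (k 1) < 0 ∧ 0 < curvNum tp (k' 0) (k' 1)

/-- The side condition an FKT-scale consumer of a `t′` cell would carry: a curvature numerator of CONSTANT SIGN along the Fermi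
curve (the level-set form of `BGM2003.DispersionHyp.convex` / FST IV's `κ ∈ [k, K]`, before quantifying the floor). [folklore] -/
def KLCurvSignConstantTP (tp μ : ℝ) : Prop :=
  (∀ k ∈ fermiCurve (squareDispersion 1 tp) μ, 0 < curvNum tp (k 0) (k 1)) ∨
  (∀ k ∈ fermiCurve (squareDispersion 1 tp) μ, curvNum tp (k 0) (k 1) < 0)

/-- An inflection excludes a curvature numerator of constant sign. [folklore] -/
theorem not_curvSignConstant_of_inflection {tp μ : ℝ} (h : KLInflectionTP tp μ) : ¬ KLCurvSignConstantTP tp μ := by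
  rintro (hpos | hneg)
  · obtain ⟨k, hk, -, -, hk0, -⟩ := h
    exact absurd (hpos k hk) (not_lt.mpr hk0.le)
  · obtain ⟨-, -, k', hk', -, hk'0⟩ := h
    exact absurd (hneg k' hk') (not_lt.mpr hk'0.le)

/-- `μ_c(t′) = 8t′ - 16t′³` lies above the band bottom `-4 - 4t′` for `-1/2 < t′`. [folklore] -/
theorem bandBottom_lt_convexityReturnLevel {tp : ℝ} (h1 : -1 / 2 < tp) (h2 : tp < 1 / 2) :
    -4 - 4 * tp < convexityReturnLevel tp := by
  unfold convexityReturnLevel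
  nlinarith [mul_pos (by linarith : (0:ℝ) < tp + 1 / 2) (by nlinarith : (0:ℝ) < (1 - tp) * 4 + 0 * tp),
    sq_nonneg tp, mul_pos (by linarith : (0:ℝ) < 1 / 2 + tp) (by linarith : (0:ℝ) < 1 / 2 - tp)]

/-- **THE Γ-SIDE CONVEXITY CHART.**  For `-1/2 < t′ < 0` and `μ_c(t′) < μ < 4t′` (hole-like curve about Γ,
between the convexity-return filling and the Van Hove filling) the Fermi curve of `ε_{t′}` has an inflection: the nodal point has
`N < 0`, the antinodal axis point has `N > 0`.  [folklore] -/
theorem gammaSide_inflection {tp μ : ℝ} (htp1 : -1 / 2 < tp) (htp0 : tp < 0)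
    (hlo : convexityReturnLevel tp < μ) (hhi : μ < 4 * tp) : KLInflectionTP tp μ := by
  have htp : |tp| < 1 / 2 := abs_lt.mpr ⟨by linarith, by linarith⟩
  -- (a) the nodal point: IVT for the diagonal level on [arccos(-2t′), π]
  set xa : ℝ := arccos (-2 * tp) with hxa
  have hxa_cos : cos xa = -2 * tp := cos_arccos (by linarith) (by linarith)
  have hxa_lt : xa < π := by
    rw [hxa]; refine arccos_lt_pi.mpr (by linarith)
  have hxa_pos : 0 < xa := arccos_pos.mpr (by linarith)
  let g : ℝ → ℝ := fun x => squareDispersion 1 tp (mk x x)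
  have hg_cont : Continuous g := by
    have : g = fun x => -4 * cos x - 4 * tp * cos x ^ 2 := by funext x; exact squareDispersion_diag tp x
    rw [this]; fun_prop
  have hga : g xa = convexityReturnLevel tp := level_at_nodal_threshold tp xa hxa_cos
  have hgπ : g π = 4 - 4 * tp := by
    show squareDispersion 1 tp (mk π π) = 4 - 4 * tp
    rw [squareDispersion_diag, cos_pi]; ring
  obtain ⟨xd, hxd, hgxd⟩ : ∃ xd ∈ Ioo xa π, g xd = μ := by
    have hsub := intermediate_value_Ioo hxa_lt.le hg_cont.continuousOn
    rw [hga, hgπ] at hsub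
    exact hsub ⟨hlo, by linarith⟩
  have hxd0 : 0 < xd := hxa_pos.trans hxd.1
  have hxdπ : xd < π := hxd.2
  -- (b) the axis point: IVT for the axis level on [0, π]
  let g0 : ℝ → ℝ := fun y => squareDispersion 1 tp (mk 0 y)
  have hg0_cont : Continuous g0 := by
    have : g0 = fun y => -2 - (2 + 4 * tp) * cos y := by funext y; exact squareDispersion_axis tp y
    rw [this]; fun_prop
  have hg00 : g0 0 = -4 - 4 * tp := by
    show squareDispersion 1 tp (mk 0 0) = -4 - 4 * tp
    rw [squareDispersion_axis, cos_zero]; ring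
  have hg0π : g0 π = 4 * tp := by
    show squareDispersion 1 tp (mk 0 π) = 4 * tp
    rw [squareDispersion_axis, cos_pi]; ring
  obtain ⟨y0, hy0, hgy0⟩ : ∃ y0 ∈ Ioo 0 π, g0 y0 = μ := by
    have hsub := intermediate_value_Ioo pi_pos.le hg0_cont.continuousOn
    rw [hg00, hg0π] at hsub
    exact hsub ⟨(bandBottom_lt_convexityReturnLevel htp1 (by linarith)).trans hlo, hhi⟩
  -- assemble
  refine ⟨mk xd xd, ⟨?_, hgxd⟩, mk 0 y0, ⟨?_, hgy0⟩, ?_, ?_⟩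
  · exact mk_mem_brillouinZone ⟨by linarith, hxdπ⟩ ⟨by linarith, hxdπ⟩
  · exact mk_mem_brillouinZone ⟨by linarith [pi_pos], pi_pos⟩ ⟨by linarith [hy0.1], hy0.2⟩
  · simpa using (nodal_neg_iff htp hxd0 hxdπ hgxd).mpr hlo
  · simpa using curvNum_axis_pos htp (sin_pos_of_pos_of_lt_pi hy0.1 hy0.2).ne'

/-- Corollary: in that band no curvature floor of either sign holds — the typed convexity input of every sector-based FKT-scale
engine in the tree is unavailable for these cells. [folklore] -/
theorem gammaSide_not_curvSignConstant {tp μ : ℝ} (htp1 : -1 / 2 < tp) (htp0 : tp < 0)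
    (hlo : convexityReturnLevel tp < μ) (hhi : μ < 4 * tp) : ¬ KLCurvSignConstantTP tp μ :=
  not_curvSignConstant_of_inflection (gammaSide_inflection htp1 htp0 hlo hhi)

/-! ### §3b  The nearest-neighbour rows (`t′ = 0`): constant positive sign  -/

/-- At `t′ = 0`: `N = 8 (cos x + cos y)(1 - cos x cos y)`. [folklore] -/
theorem curvNum_zero_tp (x y : ℝ) : curvNum 0 x y = 8 * (cos x + cos y) * (1 - cos x * cos y) := by
  have hx := sin_sq_add_cos_sq x
  have hy := sin_sq_add_cos_sq y
  simp only [curvNum, dx, dy, dxx, dyy, dxy]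
  linear_combination (8 * cos y) * hx + (8 * cos x) * hy

/-- Every point of a nearest-neighbour Fermi curve with `-4 < μ < 0` (all thirteen `t′ = 0` scan cells) has `N > 0`. [folklore] -/
theorem nn_curvNum_pos {μ : ℝ} (h4 : -4 < μ) (h0 : μ < 0) {k : Momentum}
    (hk : k ∈ fermiCurve (squareDispersion 1 0) μ) : 0 < curvNum 0 (k 0) (k 1) := by
  obtain ⟨-, hε⟩ := hk
  have hs : cos (k 0) + cos (k 1) = -μ / 2 := by
    simp [squareDispersion] at hε
    linarith
  have ha := abs_le.mp (abs_cos_le_one (k 0))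
  have hb := abs_le.mp (abs_cos_le_one (k 1))
  have hp : cos (k 0) * cos (k 1) < 1 := by
    by_contra hcon
    push Not at hcon
    have e1 : 0 ≤ (1 - cos (k 0)) * (1 + cos (k 1)) := mul_nonneg (by linarith) (by linarith)
    have e2 : 0 ≤ (1 + cos (k 0)) * (1 - cos (k 1)) := mul_nonneg (by linarith) (by linarith)
    have hab : cos (k 0) = cos (k 1) := by nlinarith
    rw [hab] at hcon hs
    have hsq : cos (k 1) * cos (k 1) = 1 := by
      have e3 : 0 ≤ (1 - cos (k 1)) * (1 + cos (k 1)) := mul_nonneg (by linarith) (by linarith)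
      nlinarith
    rcases mul_self_eq_one_iff.mp hsq with h | h
    · rw [h] at hs; linarith
    · rw [h] at hs; linarith
  rw [curvNum_zero_tp]
  have hsum : 0 < cos (k 0) + cos (k 1) := by linarith
  exact mul_pos (mul_pos (by norm_num) hsum) (by linarith)

/-- Hence the `t′ = 0` rows of the scan satisfy the constant-sign side condition. [folklore] -/
theorem nn_curvSignConstant {μ : ℝ} (h4 : -4 < μ) (h0 : μ < 0) : KLCurvSignConstantTP 0 μ :=
  Or.inl fun _ hk => nn_curvNum_pos h4 h0 hk

end Summit.HubbardSuperconductivity.HubbardSuperconductivity.Theorems.KlTPrimeConvexity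

end
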